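import Literature.Probability.RandomPlanarGeometry.HexSAWPolygonCellsRoof
import HarnessLib

/-!
# Cell calculus for honeycomb polygon surgery, V: the ROOF-END case («RU») — fill the roof under the spike and grow `UL t₀`

Topic `Literature/Probability/RandomPlanarGeometry` (lane «pcv-sawmu», a-p4 g21; sequel of `HexSAWPolygonCells.lean` and
`HexSAWPolygonCellsRoof.lean`).

The one non-recursive special case of the step-two injection «OMEGA» (`HOME/pub-sawmu-a-p4/g21/omega/THEOREM-OMEGA-g21.md` §2, base
«RU», chain index `j = 0`): the top hexagon of `B = B₀ + a_{k−1}` is the up-right spike `a_{k−1} = UR e_{k−1}` sitting at the far end of the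
roof that the type-R top `t₀` of `B₀` wants (`L t₀ ∉ B₀`, run `e_0, …, e_{k−1} ⊆ B₀`, `e_k ∉ B₀`, `k ≥ 2`).  The image is
`C(B) = B₀ ∪ roof t₀ k ∪ {UL t₀}`: the roof cells `a_0..a_{k−2}` are filled in (`−2` against `B`) and a new leaf grows at `UL t₀` (`+4`).
This file proves `perim C(B) = perim B + 2` (`perim_roofEnd`) from the roof lemma of part II, the spike count `card_contacts_roofCell_last`
(the spike `a_{k−1}` has the single contact `e_{k−1}` in `B₀`) and the leaf count `card_contacts_ul_roof` (`UL t₀` touches only `t₀` in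
`B₀ ∪ roof t₀ k`); and the two PORTS of the THEOREM's table for this base: `UR (UL t₀)` (host `t₀`) and `UR a_{k−1}` (host `a_{k−1}`) are clean
leaf spots of `C(B)` (`card_contacts_portRU_top`, `card_contacts_portRU_spike`).  The cases `j ≥ 1` of the RU-family (`L² t₀ ∈ B₀`) are the
subject of a sequel.

Sources: N. Madras, G. Slade, *The Self-Avoiding Walk* (1993), §3.2, proof of Theorem 3.2.3 [MadrasSlade1993]; I. Jensen, J. Phys.: Conf.
Ser. 42 (2006) 163 [Jensen2006HoneycombPolygons].  Label (lane): LANE INFRASTRUCTURE; nothing new in writing.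
-/

open Finset

namespace Literature.Probability.RandomPlanarGeometry.SAW

namespace HexCell

/-- **The roof-end spike**: with `t` the top hexagon, run `e_0..e_{k−1} ⊆ S`, `e_k ∉ S` and `k ≥ 2`, the hexagon `a_{k−1} = UR e_{k−1}` has the
single contact `e_{k−1}` in `S` (so `S + a_{k−1}` is `S` with an up-right spike at the far end of the roof).
[cite: MadrasSlade1993, §3.2 (proof of Theorem 3.2.3)] -/
theorem card_contacts_roofCell_last {S : Finset Cell} {t : Cell} (h : IsLexmax S t) {k : ℕ} (hk : 2 ≤ k)
    (hrun : ∀ i < k, runCell t i ∈ S) (hend : runCell t k ∉ S) :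
    roofCell t (k - 1) ∉ S ∧ #(nbrs (roofCell t (k - 1)) ∩ S) = 1 := by
  refine ⟨h.roofCell_notMem (k - 1), ?_⟩
  -- `card_contacts_roofCell` with `j = k − 1` computes the contacts in `S ∪ roof t (k−1)`; in `S` alone the left contact `a_{k−2}` is absent
  obtain ⟨a, b⟩ := t
  obtain ⟨j, rfl⟩ : ∃ j, k = j + 2 := ⟨k - 2, by omega⟩
  simp only [show j + 2 - 1 = j + 1 from rfl]
  have hll : ((a + 2 * ((j + 1 : ℕ) : ℤ) + 2 - 1, b - 1) : Cell) ∈ S := by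
    have e : runCell (a, b) (j + 1) = (a + 2 * ((j + 1 : ℕ) : ℤ) + 2 - 1, b - 1) := by ext <;> simp; ring
    rw [← e]; exact hrun (j + 1) (by omega)
  have hlr : ((a + 2 * ((j + 1 : ℕ) : ℤ) + 2 + 1, b - 1) : Cell) ∉ S := by
    have e : runCell (a, b) (j + 2) = (a + 2 * ((j + 1 : ℕ) : ℤ) + 2 + 1, b - 1) := by ext <;> simp; ring
    rw [← e]; exact hend
  have hrow : ∀ x : ℤ, ((x, b) : Cell) ∈ S → x ≤ a := by
    intro x hx
    rcases h.2 _ hx with h1 | ⟨-, h2⟩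
    · simp at h1
    · simpa using h2
  have hup : ∀ x : ℤ, ((x, b + 1) : Cell) ∉ S := fun x => h.notMem_of_row_lt (by simp)
  have e : nbrs (roofCell (a, b) (j + 1)) ∩ S = {(a + 2 * ((j + 1 : ℕ) : ℤ) + 2 - 1, b - 1)} := by
    ext d
    simp only [mem_inter, mem_nbrs_iff, roofCell_fst, roofCell_snd, mem_singleton]
    constructor
    · rintro ⟨hd, hdS⟩
      rcases hd with rfl | rfl | rfl | rfl | rfl | rfl
      · rfl
      · exact absurd hdS hlr
      · have := hrow _ hdS; push_cast at this; omega
      · exact absurd hdS (hup _)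
      · exact absurd hdS (hup _)
      · have := hrow _ hdS; push_cast at this; omega
    · rintro rfl; exact ⟨Or.inl rfl, hll⟩
  rw [e, card_singleton]

/-- `UL t` touches only `t` in `S ∪ roof t k` when `L t ∉ S`. [cite: MadrasSlade1993, §3.2 (proof of Theorem 3.2.3)] -/
theorem card_contacts_ul_roof {S : Finset Cell} {t : Cell} (h : IsLexmax S t) (hL : L t ∉ S) (k : ℕ) :
    UL t ∉ S ∪ roof t k ∧ #(nbrs (UL t) ∩ (S ∪ roof t k)) = 1 := by
  classical
  obtain ⟨a, b⟩ := t
  have hrow : ∀ c ∈ S ∪ roof (a, b) k, c.2 ≤ b := by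
    intro c hc
    rcases mem_union.1 hc with hc | hc
    · rcases h.2 c hc with h1 | ⟨h1, -⟩
      · exact h1.le
      · exact h1.le
    · obtain ⟨i, -, rfl⟩ := mem_roof.1 hc; simp
  refine ⟨fun hm => by have := hrow _ hm; simp at this, ?_⟩
  have hL' : ((a - 1 - 1, b + 1 - 1) : Cell) ∉ S ∪ roof (a, b) k := by
    rw [mem_union, not_or]
    have e : ((a - 1 - 1, b + 1 - 1) : Cell) = L (a, b) := by ext <;> simp; ring
    rw [e]
    refine ⟨hL, fun hm => ?_⟩
    obtain ⟨i, -, ei⟩ := mem_roof.1 hm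
    have := congrArg Prod.fst ei; simp only [roofCell_fst, L_fst] at this; omega
  have e : nbrs (UL (a, b)) ∩ (S ∪ roof (a, b) k) = {(a, b)} := by
    ext d
    simp only [mem_inter, mem_nbrs_iff, UL_fst, UL_snd, mem_singleton]
    constructor
    · rintro ⟨hd, hdS⟩
      rcases hd with rfl | rfl | rfl | rfl | rfl | rfl
      · exact absurd hdS hL'
      · ext <;> simp
      all_goals exfalso; have := hrow _ hdS; simp at this
    · rintro rfl
      exact ⟨Or.inr (Or.inl (by ext <;> simp)), mem_union_left _ h.1⟩
  rw [e, card_singleton]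

/-- ★ **The roof-end move is a `+2` move.**  `B = B₀ + a_{k−1}` (the spike at the roof's end, `k ≥ 2`, `e_k ∉ B₀`, `L t₀ ∉ B₀`) and
`C(B) = B₀ ∪ roof t₀ k ∪ {UL t₀}` satisfy `perim C(B) = perim B + 2`.
[cite: MadrasSlade1993, §3.2, Theorem 3.2.3 (3.2.3) and its proof, transplanted to `ℍ`] -/
theorem perim_roofEnd {B₀ : Finset Cell} {t₀ : Cell} (h : IsLexmax B₀ t₀) (hL : L t₀ ∉ B₀) {k : ℕ} (hk : 2 ≤ k)
    (hrun : ∀ i < k, runCell t₀ i ∈ B₀) (hend : runCell t₀ k ∉ B₀) :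
    perim (insert (UL t₀) (B₀ ∪ roof t₀ k)) = perim (insert (roofCell t₀ (k - 1)) B₀) + 2 := by
  classical
  obtain ⟨hsp, hsp1⟩ := card_contacts_roofCell_last h hk hrun hend
  obtain ⟨hul, hul1⟩ := card_contacts_ul_roof h hL k
  rw [perim_insert_of_contacts_eq_one hul hul1, perim_union_roof_of_isLexmax h (by omega) hrun hend,
    perim_insert_of_contacts_eq_one hsp hsp1]

/-- The image indeed contains the source: `B = B₀ + a_{k−1} ⊆ B₀ ∪ roof t₀ k`. [cite: MadrasSlade1993, §3.2 (proof of Theorem 3.2.3)] -/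
theorem insert_roofCell_subset_union_roof (B₀ : Finset Cell) (t₀ : Cell) {k : ℕ} (hk : 1 ≤ k) :
    insert (roofCell t₀ (k - 1)) B₀ ⊆ B₀ ∪ roof t₀ k := by
  intro c hc
  rcases mem_insert.1 hc with rfl | hc
  · exact mem_union_right _ (mem_roof.2 ⟨k - 1, by omega, rfl⟩)
  · exact mem_union_left _ hc

/-- ★ **Port of `t₀` in the roof-end image**: `UR (UL t₀) = (t₀.x, t₀.y + 2)` is a clean leaf spot of `C(B)`.
[cite: MadrasSlade1993, §3.2 (proof of Theorem 3.2.3: re-attaching at the image's top)] -/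
theorem card_contacts_portRU_top {B₀ : Finset Cell} {t₀ : Cell} (h : IsLexmax B₀ t₀) (k : ℕ) :
    UR (UL t₀) ∉ insert (UL t₀) (B₀ ∪ roof t₀ k) ∧ #(nbrs (UR (UL t₀)) ∩ insert (UL t₀) (B₀ ∪ roof t₀ k)) = 1 := by
  classical
  obtain ⟨a, b⟩ := t₀
  have hrow : ∀ c ∈ insert (UL (a, b)) (B₀ ∪ roof (a, b) k), c.2 ≤ b + 1 ∧ (c.2 = b + 1 → c = UL (a, b)) := by
    intro c hc
    rcases mem_insert.1 hc with rfl | hc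
    · simp
    · rcases mem_union.1 hc with hc | hc
      · rcases h.2 c hc with h1 | ⟨h1, -⟩ <;> exact ⟨by omega, fun h2 => by omega⟩
      · obtain ⟨i, -, rfl⟩ := mem_roof.1 hc; simp
  refine ⟨fun hm => by have := (hrow _ hm).1; simp at this, ?_⟩
  have e : nbrs (UR (UL (a, b))) ∩ insert (UL (a, b)) (B₀ ∪ roof (a, b) k) = {UL (a, b)} := by
    ext d
    simp only [mem_inter, mem_nbrs_iff, UR_fst, UR_snd, UL_fst, UL_snd, mem_singleton]
    constructor
    · rintro ⟨hd, hdS⟩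
      obtain ⟨h1, h2⟩ := hrow _ hdS
      rcases hd with rfl | rfl | rfl | rfl | rfl | rfl
      · ext <;> simp
      · have e := h2 (by simp); have := congrArg Prod.fst e; simp at this; omega
      all_goals simp at h1
    · rintro rfl
      exact ⟨Or.inl (by ext <;> simp), mem_insert_self _ _⟩
  rw [e, card_singleton]

/-- ★ **Port of the spike `a_{k−1}` in the roof-end image**: `UR a_{k−1}` is a clean leaf spot of `C(B)` (`k ≥ 2`, `e_k ∉ B₀`).
[cite: MadrasSlade1993, §3.2 (proof of Theorem 3.2.3)] -/
theorem card_contacts_portRU_spike {B₀ : Finset Cell} {t₀ : Cell} (h : IsLexmax B₀ t₀) {k : ℕ} (hk : 2 ≤ k) (hend : runCell t₀ k ∉ B₀) :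
    UR (roofCell t₀ (k - 1)) ∉ insert (UL t₀) (B₀ ∪ roof t₀ k) ∧
      #(nbrs (UR (roofCell t₀ (k - 1))) ∩ insert (UL t₀) (B₀ ∪ roof t₀ k)) = 1 := by
  classical
  -- from part II's roof port (`card_contacts_portR`-style facts) plus: `UL t₀` is far to the left of `UR a_{k−1}`
  obtain ⟨a, b⟩ := t₀
  obtain ⟨j, rfl⟩ : ∃ j, k = j + 1 := ⟨k - 1, by omega⟩
  simp only [Nat.add_sub_cancel]
  have hrow : ∀ c ∈ B₀ ∪ roof (a, b) (j + 1), c.2 ≤ b := by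
    intro c hc
    rcases mem_union.1 hc with hc | hc
    · rcases h.2 c hc with h1 | ⟨h1, -⟩
      · exact h1.le
      · exact h1.le
    · obtain ⟨i, -, rfl⟩ := mem_roof.1 hc; simp
  have hne : UR (roofCell (a, b) j) ≠ UL (a, b) := by
    intro e; have := congrArg Prod.fst e; simp only [UR_fst, roofCell_fst, UL_fst] at this; omega
  refine ⟨?_, ?_⟩
  · rw [mem_insert, not_or]
    exact ⟨hne, fun hm => by have := hrow _ hm; simp at this⟩
  have hnotadj : UL (a, b) ∉ nbrs (UR (roofCell (a, b) j)) := by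
    simp only [mem_nbrs_iff, UR_fst, UR_snd, roofCell_fst, roofCell_snd, UL, Prod.mk.injEq, not_or]
    omega
  rw [insert_eq, inter_union_distrib_left, inter_singleton_of_notMem hnotadj, empty_union]
  have e : nbrs (UR (roofCell (a, b) j)) ∩ (B₀ ∪ roof (a, b) (j + 1)) = {roofCell (a, b) j} := by
    ext c
    simp only [mem_inter, mem_nbrs_iff, UR_fst, UR_snd, roofCell_fst, roofCell_snd, mem_singleton]
    constructor
    · rintro ⟨hc, hcS⟩
      rcases hc with rfl | rfl | rfl | rfl | rfl | rfl
      · ext <;> simp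
      · exfalso
        rcases mem_union.1 hcS with hc | hc
        · exact h.notMem_of_right (by simp) (by simp; omega) hc
        · obtain ⟨i, hi, ei⟩ := mem_roof.1 hc
          have := congrArg Prod.fst ei; simp only [roofCell_fst] at this; omega
      all_goals exfalso; have := hrow _ hcS; simp at this
    · rintro rfl
      exact ⟨Or.inl (by ext <;> simp), mem_union_right _ (mem_roof.2 ⟨j, by omega, rfl⟩)⟩
  rw [e, card_singleton]

end HexCell

end Literature.Probability.RandomPlanarGeometry.SAW
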